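import Summits.HodgeConjecture.HodgeConjecture.Cruxes.H413.Lines.F0_P3c_PKtuplePaydown     -- the tree LEAF (ED. 6 «O1‴∕O2′», commit 3957fe445a81): ORGAN 2 `F0U3LettersRung1.PKrigidCoreLetter` (O2′) and its frame (`ComparisonKit`, `IsPinned`, ★ `transportAPackets`, …)
import Summits.HodgeConjecture.HodgeConjecture.Theorems.R90S7RigidCoreDefs               -- ★ p862183 (R90-C146-p01, S7-J2★ DEFS v3) the predicate `R90.S7.QsRigidCore L` — Thm. 13.3.6 (c) + 13.3.5 on the quasi-split `U(Φ₃)` of the CM field, finite part (EDITION 1 import)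
import Summits.HodgeConjecture.HodgeConjecture.Theorems.R90S7RigidCoreOfQsRigidity       -- ★ p862703 (R90-C146-p01, S7-J2★ JUNCTION, KIT-FREE, commit 2335c1689c38) `R90.S7.pkRigidCore_of_qsRigidCore : (∀ L, QsRigidCore L) → O2′ with the kit dissolved into `ψ, hψ, μG, hAutG`
import HarnessLib

/-!
# R90-TF · S7 «§14.6 PK-tuple assembly» — FILE C «RIGID-CORE JUNCTION», EDITION 2 (SOCKET + HEAD): `stub_R90_S7_qsRigidCore : ∀ L (CM field), QsRigidCore L`
# (EDITION 1 bytes, untouched) and the head `pkRigidCore_paid : F0U3LettersRung1.PKrigidCoreLetter` = ★ `pkRigidCore_of_qsRigidCore stub_R90_S7_qsRigidCore` read in the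
# letter's frame (the kit's `𝔨.ψ` + pin (vii-c), `𝔨.μG` + pin (iii)) — leaf organ O2′ PAID modulo the one socket

Cell `hodgecm-mathlib`, crux H413 (`stmt-HodgeConjecture-24833`), route of record `HCCMUnconditional`; programme R90-TF (Amendment 2), section S7 = Ch. 14.6
(base `R90-C146`), seat LH7-typ2 (g0) = S7 typist #2; dealer∕pen LH7-plan (g4) RULINGS S7-R8 (file C), S7-R9 (1) (O2 = option (B): the upstream is O2's OWN BODY
read at `H := qsForm L`), S7-R11 (a) (Defs ∕ junction split), S7-R12 (no ψ-hypothesis in the LETTER: ★ `ComparisonKit.IsPinned.psiConj`; the ★ junction is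
kit-free and receives `ψ := 𝔨.ψ` with pin (vii-c) as its `hψ`), S7-R13 (sequencing: the socket edition was window-immune; this head edition follows leaf ED. 6
«O1‴∕O2′», WRITTEN 2026-09-04T22:28:32Z in the F11 ⊕ F12 window, CLOSED 22:46:14Z, and the ★ junction p862703, ACCEPTED 22:48:14Z), S7-R14 (statement shape
F2: supercuspidal-partner DATUM `hSC` + its PIN `hSCid`), S7-R16 (d) (this socket is the PRINT SHELL on the full-trace-formula road, OFF the h413 critical path;
the on-path two-place edition `stub_R90_S7_qsRigidCore₂` is a LATER edition with its OWN `sorry`, typed together with the kit-index cut — R90-TF LEAD #33 (A));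
audits LH7-audit1 (g0) BOX S7 DEFS v2 PASS, DELTA BOX C ED. 1 → ED. 2 PASS-TEXT (21:49:59Z), BOX S7-J2 TRANSPORT HALF PASS ×3 (22:11:54Z), LH7-audit1 (g2) BOX
S7-J2 JUNCTION v2 BY IMPORT KERNEL GREEN + GATE-LANE FINDING (22:46:51Z: a `Theorems` module may not import a `Cruxes/…/Lines` module — `lint.import`), RESOLVED
by R90-C146-p01 (g0)'s KIT-FREE RE-SHAPE ★ p862703 (22:47:53Z ∕ 22:48:14Z) + its HEAD SNIPPET of record `R90/R90-C146-p01/g0/HEADC-pkRigidCore_paid.snippet.v1.lean`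
3d1f585f7092733f (GREEN BY PASTE vs the tree leaf ED. 6: rc 0 ∕ 0 ∕ 0 ∕ TRIO with `hQS` a hypothesis); EXPORT-EDGES-S7 v3.4 row 12 (LH7-typ2).

## What this file is (EDITION 2)
* ONE SOCKET `stub_R90_S7_qsRigidCore (L) [Field L] [NumberField L] [IsCMField L] : QsRigidCore L` — EDITION 1 decl bytes UNTOUCHED (C3∕T1): print Thm. 13.3.6 (c)
  (+ Thm. 13.3.5; §13.1 p. 199 «`Π(ξ)_v = {πⁿ(ξ_v), πˢ(ξ_v)}`», Prop. 13.1.3 (d), [13.1.4]) ON THE QUASI-SPLIT UNITARY GROUP `U(Φ₃)` over `L⁺`, FINITE PART: a family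
  `π = (π_v)_v` occurring in the discrete spectrum of `U(Φ₃)` with `π_v = πⁿ(ξ_v)` for almost all finite `v` has `π_v ∈ {πⁿ(ξ_v), πˢ(ξ_v)}` at EVERY finite `v` —
  stated over the INTRINSIC record packets ★ `xiPacketFamilyOfRecordSCD L (qsForm L) …` whose second member is the datum `hSC` PINNED by `hSCid` — H-free,
  kit-free, ψ-free.  Statement TEXT = ★ predicate `R90.S7.QsRigidCore L` (R90-C146-p01 Defs v3).
* ONE HEAD `pkRigidCore_paid : F0U3LettersRung1.PKrigidCoreLetter` — R90-C146-p01 (g0)'s snippet of record 3d1f585f7092733f lines 9–22 VERBATIM: `intro` the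
  letter's 58 binders in leaf-head order, then `exact pkRigidCore_of_qsRigidCore stub_R90_S7_qsRigidCore L H (transpose_map_cmConjRingHom_eq_of_frame L ι H T hT)
  (isUnit_det_of_frame L ι H T hT) μω hμu hμω νH νG μZ ‹Haar ∕ right-invariance› hquad mH mG hcan 𝔨.ψ ‹pin (vii-c) = conjunct 29 of IsPinned› 𝔨.μG hpin.2.2.1 hQ hK`
  (the ★ junction is KIT-FREE — the gate's `lint.import` keeps `ComparisonKit`∕`IsPinned`∕`PKrigidCoreLetter` out of `Theorems/` — so the kit is dissolved HERE, in
  the Lines file that may import the leaf; same discipline as the leaf's TIED organs ★ p848182 ∕ p848190 ∕ p848874).  `#print axioms pkRigidCore_paid` =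
  [propext, sorryAx, Classical.choice, Quot.sound], `sorryAx` from `stub_R90_S7_qsRigidCore` ONLY (the junction is ★, TRIO).  CONSUMER: `R90_TF_Index` R4
  `pk_of_printOrgans (hBase) (hRC := R90.S7.pkRigidCore_paid)` by name (registrar ∕ S8∕CS pen), when the Index is re-pointed.
* EDITION 2 = EDITION 1 + TWO import lines (the tree leaf + the ★ junction) + two `open` lines + ONE decl APPENDED (`pkRigidCore_paid`); no decl re-worded in
  place (C3∕T1).

## Import law (L9, EDITION 2 reading — R90-C146-p01 (g0) 22:47:53Z (1)∕(3), LH7-audit1 (g2) 22:46:51Z; pen LH7-plan (g4))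
★ `Theorems` + the tree LEAF `Lines.F0_P3c_PKtuplePaydown` (needed to NAME `PKrigidCoreLetter`; the ★ junction cannot import it) + `HarnessLib` ONLY; NEVER file A
(`R90_S7_PKtupleBaseChainA`) or file B (`R90_S7_PKtupleSignsB`).  Nothing imports C except the index ∕ closer that feeds `hRC` by name.

## Honest label
A socket PAYS NOTHING until proved; the junction closes no citation.  HC_CM is proved only modulo the 7 printed citations (2 remaining named inputs: hLiu418 =
stmt-HodgeConjecture-24832, h413 = stmt-HodgeConjecture-24833) until rung 0 closes; count-neutral (a Lines edition: 0 proposals ∕ 0 registry acts).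

## References
* [Rogawski1990] J. D. Rogawski, *Automorphic Representations of Unitary Groups in Three Variables*, Ann. of Math. Stud. 123 (1990): §13.3 Thm. 13.3.5,
  Thm. 13.3.6 (c) p. 202, Thm. 13.3.7 p. 203; §13.1 Prop. 13.1.3 (d), Prop. 13.1.4 p. 199; §12.2 (2) pp. 173–174; §13.6 pp. 210–217; §13.8 pp. 222–226;
  §14.1–§14.2 pp. 232–234; §14.6 p. 242.
-/

set_option autoImplicit false
-- the mandated namespace repeats the single-problem summit's segment (`HodgeConjecture.HodgeConjecture`)
set_option linter.dupNamespace false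

namespace Summit.HodgeConjecture.HodgeConjecture.R90.S7

/-- **SOCKET S7#C1 `stub_R90_S7_qsRigidCore` — Thm. 13.3.6 (c) + 13.3.5 ON `U(Φ₃)` (finite part), AT PRINT'S PINNED DATA.**  Statement = ★ predicate `R90.S7.QsRigidCore L`
(R90-C146-p01 Defs v3, F2) AT EVERY CM field `L`: print's Φ₃-side data (explicit `Δ = Δ‴_{Φ₃}` ★ `finExplicitCollection L (qsForm L) μω …`, CANONICAL orbital
families `m_H, m_G`, Haar `ν_G, ν_H` — binders of S5 D `SocketQsScUnique` verbatim), a unitary Hecke character `μω` restricting to `ω_{L∕L⁺}` (`hμω`), Haar data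
`μZ` on `U(Φ₃)_v ∕ Z`, Keys' case (2) `hK`, the local frame hypothesis `hquad`, and a supercuspidal-partner DATUM `hSC` PINNED by `hSCid` (the SIGNED [13.1.4] on
test functions for `{πⁿ(ξ_v) ∘ e_T, πˢ}` at `(Δ_v, m_H, m_G, ν_G, ν_H, ξ_v)`, clause sign `[a ∈ z z̄]`; bytes = ★ `charIdentityAtTestSigned_hSCD` at `H := qsForm L`):
every family `π = (π_v)_v` OCCURRING in the discrete spectrum of an automorphic measure `μG` on `U(Φ₃)(L⁺)\U(Φ₃)(𝔸_{L⁺})` (★ `cmOccursInDiscreteSpectrum`) with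
`π_v = πⁿ(ξ_v)` (record ★ `xiPacketFamilyOfRecordSCD L (qsForm L) …`) for all but finitely many finite `v` satisfies `π_v = πⁿ(ξ_v) ∨ πˢ(ξ_v) = π_v` at EVERY
finite `v` (split `v`: `πˢ` is absent and the clause reads `π_v = πⁿ(ξ_v)`).
WHY IT MIGHT FAIL: only as print fails — it IS Rogawski's Thm. 13.3.6 (c) with 13.3.5 on `U(3)` (global: the §13.6 comparison of trace formulas + the §13.8
e.v.p. separation); a junk partner violates `hSCid` (with Haar, canonical families and `Δ‴` fixed the signed identity determines the supercuspidal class,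
★ `R90.S5.eq_of_charIdentityAtTestSigned`); where no Δ‴-transfer pair of test functions exists `hSCid` is vacuous — irrelevant in print (local transfer EXISTS,
Prop. 4.9.1; R90 floor (E1)) and the PAYER consumes that floor by name (S7-R14 (b)).  Size XL in-house (road: the §13.6 machinery on the quasi-split group,
S5∕S10), print-exact.  JUNK TESTS: J5 (free supercuspidal partner — the withdrawn v1 shape) is killed by `hSCid`; J1–J4 (junk kits) do not apply (kit-free).
SOURCES: [cite: Rogawski1990, §13.3 Thm. 13.3.6 (c), Thm. 13.3.5 p. 202, Thm. 13.3.7 p. 203; §13.1 Prop. 13.1.3 (d), Prop. 13.1.4 p. 199; §12.2 (2) pp. 173–174; §4.9 Prop. 4.9.1 p. 55].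
CONSUMER: EDITION 2's head `pkRigidCore_paid` (leaf organ O2′) via ★ `pkRigidCore_of_qsRigidCore`; S5∕S10 payers meet the datum through
`hSCid` + ★ p861393 in their own currency (`hSC := hSCD_of_… hQS`, `hSCid := charIdentityAtTestSigned_hSCD hQS`). -/
theorem stub_R90_S7_qsRigidCore (L : Type) [Field L] [NumberField L] [NumberField.IsCMField L] : QsRigidCore L := by
  sorry

/-! ## EDITION 2 — the head (R90-C146-p01 (g0)'s snippet of record `HEADC-pkRigidCore_paid.snippet.v1.lean` 3d1f585f7092733f, lines 9–22 verbatim below the two `open`s) -/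

open Literature.NumberTheory.Rogawski1990             -- `transpose_map_cmConjRingHom_eq_of_frame`, `isUnit_det_of_frame`
open Summit.HodgeConjecture.HodgeConjecture.Cruxes.H413   -- `F0U3LettersRung1.PKrigidCoreLetter`

set_option synthInstance.maxHeartbeats 400000 in
set_option maxHeartbeats 4000000 in
/-- **ORGAN 2 (O2′) PAID MODULO THE SOCKET**: `PKrigidCoreLetter` (leaf ED. 6) from S7's socket `stub_R90_S7_qsRigidCore : ∀ L, QsRigidCore L` (Thm. 13.3.6 (c) + 13.3.5 on
`U(Φ₃)` at print's pinned data) by the ★ kit-free junction `pkRigidCore_of_qsRigidCore`: the kit is dissolved into `𝔨.ψ` (pin (vii-c) = conjunct 29 of `IsPinned`,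
★ `IsPinned.psiConj`'s projection, instance-free) and `𝔨.μG` (pin (iii) `hpin.2.2.1`); axioms = TRIO + `sorryAx` from the socket ONLY.
[cite: Rogawski1990, §13.3 Thm. 13.3.6 (c) p. 202; §14.1–14.2 pp. 232–234] -/
theorem pkRigidCore_paid : F0U3LettersRung1.PKrigidCoreLetter := by
  intro L _ _ _ ι H T hT μ _ μω hμu hμω ν νH νG νGi νqi νHi μZ isHaar_ν isInvInv_ν isHaar_νH isRightInv_νH isHaar_νG isRightInv_νG
    finCpt_νGi rightInv_νGi finCpt_νqi rightInv_νqi finCpt_νHi rightInv_νHi isHaar_μZ hquad hvol hvolH c wXi jInf dsInf mH mG hcan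
    𝔨 hpin hTE hSTF hΔ hmH hmG hQ hK hLi hg hsm S₀ hS₀
  -- pin (vii-c) `PinPsiConj` = conjunct 29 of 39 of `IsPinned` (★ `IsPinned.psiConj`'s projection, instance-free), pin (iii) `hpin.2.2.1` = `μG` automorphic
  exact pkRigidCore_of_qsRigidCore stub_R90_S7_qsRigidCore L H (transpose_map_cmConjRingHom_eq_of_frame L ι H T hT) (isUnit_det_of_frame L ι H T hT) μω hμu hμω νH νG μZ
    isHaar_νH isRightInv_νH isHaar_νG isRightInv_νG isHaar_μZ hquad mH mG hcan 𝔨.ψ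
    hpin.2.2.2.2.2.2.2.2.2.2.2.2.2.2.2.2.2.2.2.2.2.2.2.2.2.2.2.2.1 𝔨.μG hpin.2.2.1 hQ hK

end Summit.HodgeConjecture.HodgeConjecture.R90.S7
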